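import Mathlib
import HarnessLib
import Summits.Parity.BatemanHorn.Theorems.IsogenyRedeiSplitBlockJacobiWeylDefs
import Summits.Parity.BatemanHorn.Theorems.IsogenyRedeiSplitBlockJacobiCornerMbbPieceI

/-!
# Support lemmas for `stub_mbb_of_boxInputs` (line `Sketch`, crux `SplitBlockJacobiCorner`,
# stmt-Parity-15002): from the K1′ box bound to the Type I × Type I piece

Def-free (the K1′ kernel `smoothTwistedBoxSum k d d' A A' B B'` is written out as its body).
`typeI_typeI_bound`: if for all levels `d, d' ≤ U²`, `d ≡ d' ≡ 1 (4)`, the box sums over the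
dyadic-compatible boxes `(A₀, m] × (B₀, m']`, `A₀ ∈ {P/d, 2(P/d)}`, `B₀ ∈ {P'/d', 2(P'/d')}` are
`≤ Z₀` (this is what K1′ supplies), and the weights `u_d, v_{d'}` have variation `≤ V` and vanish for
levels `> U²`, then the expanded Type I × Type I piece (`typeI_typeI_expand` form) is at most
`(U²)² · 4Z₀ · V²`.
-/

noncomputable section

open Finset

namespace Summit.Parity.BatemanHorn.Cruxes.SplitBlockJacobiCorner.Sketch.MbbOfBoxInputs

open Summit.Parity.BatemanHorn.Cruxes.SplitBlockJacobi.CofactorRootDiscrepancy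

/-- The filtered box sum (body of `smoothTwistedBoxSum`) as an indicator double sum. [folklore] -/
theorem box_filter_eq_ite (k : ℤ) (d d' A A' B B' : ℕ) :
    ∑ n ∈ (Ioc A A').filter (fun n : ℕ => n % 4 = 1),
        ∑ q ∈ (Ioc B B').filter (fun q : ℕ => q % 4 = 1),
          (jacobiSym ((d * n : ℕ) : ℤ) (d' * q) : ℂ) * rootWeylSum k (d * n * (d' * q)) =
      ∑ n ∈ Ioc A A', ∑ q ∈ Ioc B B',
        (if n % 4 = 1 ∧ q % 4 = 1 then
          (jacobiSym ((d * n : ℕ) : ℤ) (d' * q) : ℂ) * rootWeylSum k (d * n * (d' * q)) else 0) := by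
  rw [Finset.sum_filter]
  refine Finset.sum_congr rfl fun n _ => ?_
  rw [Finset.sum_filter]
  split_ifs with hn
  · refine Finset.sum_congr rfl fun q _ => ?_
    simp [hn]
  · symm
    refine Finset.sum_eq_zero fun q _ => ?_
    simp [hn]

/-- `⌊t/d⌋ ≤ 2⌊P/d⌋ + 1` for `t ≤ 2P`. [folklore] -/
theorem div_le_two_mul_div_add_one {t P d : ℕ} (ht : t ≤ 2 * P) : t / d ≤ 2 * (P / d) + 1 := by
  rcases Nat.eq_zero_or_pos d with rfl | hd
  · simp
  have h1 : P < P / d * d + d := Nat.lt_div_mul_add hd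
  have h2 : t < (2 * (P / d) + 2) * d :=
    calc t ≤ 2 * P := ht
      _ < 2 * (P / d * d + d) := by omega
      _ = (2 * (P / d) + 2) * d := by ring
  exact Nat.le_of_lt_succ ((Nat.div_lt_iff_lt_mul hd).mpr h2)

/-- **The Type I × Type I piece from the K1′ box bound.** See the module docstring. [folklore] -/
theorem typeI_typeI_bound (h : ℤ) (U P t P' t' : ℕ) (u v : ℕ → ℕ → ℂ) {Z₀ V : ℝ} (hZ₀ : 0 ≤ Z₀)
    (hV : 0 ≤ V) (hUP : U * U ≤ P) (hUP' : U * U ≤ P') (ht : t ≤ 2 * P) (ht' : t' ≤ 2 * P')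
    (hu0 : ∀ d n, U * U < d → u d n = 0) (hv0 : ∀ d' q, U * U < d' → v d' q = 0)
    (hu : ∀ d A A₁ : ℕ, d ≤ U * U → 1 ≤ A → A ≤ A₁ → A₁ ≤ t →
      ‖u d A₁‖ + ∑ m ∈ Ico A A₁, ‖u d (m + 1) - u d m‖ ≤ V)
    (hv : ∀ d' B B₁ : ℕ, d' ≤ U * U → 1 ≤ B → B ≤ B₁ → B₁ ≤ t' →
      ‖v d' B₁‖ + ∑ m ∈ Ico B B₁, ‖v d' (m + 1) - v d' m‖ ≤ V)
    (hK1 : ∀ d d' : ℕ, 1 ≤ d → d ≤ U * U → 1 ≤ d' → d' ≤ U * U → d % 4 = 1 → d' % 4 = 1 →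
      ∀ A₀ B₀ m m' : ℕ, (A₀ = P / d ∨ A₀ = 2 * (P / d)) → (B₀ = P' / d' ∨ B₀ = 2 * (P' / d')) →
        A₀ ≤ m → m ≤ 2 * A₀ → B₀ ≤ m' → m' ≤ 2 * B₀ →
          ‖∑ n ∈ (Ioc A₀ m).filter (fun n : ℕ => n % 4 = 1),
              ∑ q ∈ (Ioc B₀ m').filter (fun q : ℕ => q % 4 = 1),
                (jacobiSym ((d * n : ℕ) : ℤ) (d' * q) : ℂ) * rootWeylSum h (d * n * (d' * q))‖ ≤ Z₀) :
    ‖∑ d ∈ Ioc 0 t, ∑ d' ∈ Ioc 0 t',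
        if d % 4 = 1 ∧ d' % 4 = 1 then
          ∑ n ∈ Ioc (P / d) (t / d), ∑ q ∈ Ioc (P' / d') (t' / d'),
            (if n % 4 = 1 ∧ q % 4 = 1 then
                (jacobiSym ((d * n : ℕ) : ℤ) (d' * q) : ℂ) * rootWeylSum h (d * n * (d' * q)) else 0) *
              (u d n * v d' q)
        else 0‖ ≤ ((U * U : ℕ) : ℝ) ^ 2 * (4 * Z₀) * V ^ 2 := by
  -- the per-level bound
  have hper : ∀ d ∈ Ioc 0 t, ∀ d' ∈ Ioc 0 t',
      ‖(if d % 4 = 1 ∧ d' % 4 = 1 then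
          ∑ n ∈ Ioc (P / d) (t / d), ∑ q ∈ Ioc (P' / d') (t' / d'),
            (if n % 4 = 1 ∧ q % 4 = 1 then
                (jacobiSym ((d * n : ℕ) : ℤ) (d' * q) : ℂ) * rootWeylSum h (d * n * (d' * q)) else 0) *
              (u d n * v d' q)
        else 0 : ℂ)‖ ≤
        if d ≤ U * U ∧ d' ≤ U * U then 4 * Z₀ * (V * V) else 0 := by
    intro d hd d' hd'
    have hd1 : 1 ≤ d := (Finset.mem_Ioc.mp hd).1
    have hd'1 : 1 ≤ d' := (Finset.mem_Ioc.mp hd').1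
    by_cases hlev : d ≤ U * U ∧ d' ≤ U * U
    · rw [if_pos hlev]
      split_ifs with hD
      · -- the genuine case: Abel against the tensor weight, boxes from K1′
        set A := P / d with hA
        set A₁ := t / d with hA₁
        set B := P' / d' with hB
        set B₁ := t' / d' with hB₁
        have hA1 : 1 ≤ A := by
          rw [hA, Nat.le_div_iff_mul_le (by omega), one_mul]; exact hlev.1.trans hUP
        have hB1 : 1 ≤ B := by
          rw [hB, Nat.le_div_iff_mul_le (by omega), one_mul]; exact hlev.2.trans hUP'
        have hA₁ : A₁ ≤ 2 * A + 1 := div_le_two_mul_div_add_one ht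
        have hB₁ : B₁ ≤ 2 * B + 1 := div_le_two_mul_div_add_one ht'
        rcases lt_or_ge A₁ A with hlt | hAA
        · rw [Finset.Ioc_eq_empty (by omega), Finset.sum_empty, norm_zero]; positivity
        rcases lt_or_ge B₁ B with hlt | hBB
        · rw [Finset.sum_eq_zero (fun n _ => by rw [Finset.Ioc_eq_empty (by omega), Finset.sum_empty]),
            norm_zero]; positivity
        set f : ℕ → ℕ → ℂ := fun n q => if n % 4 = 1 ∧ q % 4 = 1 then
            (jacobiSym ((d * n : ℕ) : ℤ) (d' * q) : ℂ) * rootWeylSum h (d * n * (d' * q)) else 0 with hf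
        have hbox : ∀ m ∈ Icc A (2 * A + 1), ∀ m' ∈ Icc B (2 * B + 1),
            ‖∑ n ∈ Ioc A m, ∑ q ∈ Ioc B m', f n q‖ ≤ 4 * Z₀ := by
          refine box_split f hA1 hB1 hZ₀ ?_
          intro A₀ B₀ m m' hA₀ hB₀ h1 h2 h3 h4
          have := hK1 d d' hd1 hlev.1 hd'1 hlev.2 hD.1 hD.2 A₀ B₀ m m' hA₀ hB₀ h1 h2 h3 h4
          rwa [box_filter_eq_ite] at this
        have hbox' : ∀ m ∈ Icc A A₁, ∀ m' ∈ Icc B B₁,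
            ‖∑ n ∈ Ioc A m, ∑ q ∈ Ioc B m', f n q‖ ≤ 4 * Z₀ := by
          intro m hm m' hm'
          rw [Finset.mem_Icc] at hm hm'
          exact hbox m (Finset.mem_Icc.mpr ⟨hm.1, hm.2.trans hA₁⟩) m'
            (Finset.mem_Icc.mpr ⟨hm'.1, hm'.2.trans hB₁⟩)
        have hA₁t : A₁ ≤ t := Nat.div_le_self t d
        have hB₁t : B₁ ≤ t' := Nat.div_le_self t' d'
        have key := weighted_box_bound f (u d) (v d') hAA hBB hbox' (hu d A A₁ hlev.1 hA1 hAA hA₁t)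
          (hv d' B B₁ hlev.2 hB1 hBB hB₁t)
        simpa only [hf] using key
      · rw [norm_zero]; positivity
    · -- a level above `U²`: the weight vanishes
      rw [if_neg hlev]
      have h0 : (if d % 4 = 1 ∧ d' % 4 = 1 then
          ∑ n ∈ Ioc (P / d) (t / d), ∑ q ∈ Ioc (P' / d') (t' / d'),
            (if n % 4 = 1 ∧ q % 4 = 1 then
                (jacobiSym ((d * n : ℕ) : ℤ) (d' * q) : ℂ) * rootWeylSum h (d * n * (d' * q)) else 0) *
              (u d n * v d' q)
        else 0 : ℂ) = 0 := by
        split_ifs with hD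
        · refine Finset.sum_eq_zero fun n _ => Finset.sum_eq_zero fun q _ => ?_
          rcases not_and_or.mp hlev with h1 | h1
          · rw [hu0 d n (not_le.mp h1)]; simp
          · rw [hv0 d' q (not_le.mp h1)]; simp
        · rfl
      rw [h0, norm_zero]
  -- sum the per-level bounds
  calc _ ≤ ∑ d ∈ Ioc 0 t, ‖∑ d' ∈ Ioc 0 t',
          (if d % 4 = 1 ∧ d' % 4 = 1 then
            ∑ n ∈ Ioc (P / d) (t / d), ∑ q ∈ Ioc (P' / d') (t' / d'),
              (if n % 4 = 1 ∧ q % 4 = 1 then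
                  (jacobiSym ((d * n : ℕ) : ℤ) (d' * q) : ℂ) * rootWeylSum h (d * n * (d' * q)) else 0) *
                (u d n * v d' q)
          else 0 : ℂ)‖ := norm_sum_le _ _
    _ ≤ ∑ d ∈ Ioc 0 t, ∑ d' ∈ Ioc 0 t', (if d ≤ U * U ∧ d' ≤ U * U then 4 * Z₀ * (V * V) else 0) :=
        Finset.sum_le_sum fun d hd => (norm_sum_le _ _).trans (Finset.sum_le_sum fun d' hd' => hper d hd d' hd')
    _ = ∑ d ∈ (Ioc 0 t).filter (fun d => d ≤ U * U),
          ∑ d' ∈ (Ioc 0 t').filter (fun d' => d' ≤ U * U), 4 * Z₀ * (V * V) := by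
        rw [Finset.sum_filter]
        refine Finset.sum_congr rfl fun d _ => ?_
        rw [Finset.sum_filter]
        split_ifs with h1
        · refine Finset.sum_congr rfl fun d' _ => ?_
          simp [h1]
        · simp [h1]
    _ ≤ ∑ d ∈ Ioc 0 (U * U), ∑ d' ∈ (Ioc 0 t').filter (fun d' => d' ≤ U * U), 4 * Z₀ * (V * V) := by
        apply Finset.sum_le_sum_of_subset_of_nonneg
        · intro d hd
          rw [Finset.mem_filter, Finset.mem_Ioc] at hd
          rw [Finset.mem_Ioc]; omega
        · intro d _ _; exact Finset.sum_nonneg fun _ _ => by positivity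
    _ ≤ ∑ d ∈ Ioc 0 (U * U), ∑ d' ∈ Ioc 0 (U * U), 4 * Z₀ * (V * V) := by
        refine Finset.sum_le_sum fun d _ => ?_
        apply Finset.sum_le_sum_of_subset_of_nonneg
        · intro d' hd'
          rw [Finset.mem_filter, Finset.mem_Ioc] at hd'
          rw [Finset.mem_Ioc]; omega
        · intro _ _ _; positivity
    _ = ((U * U : ℕ) : ℝ) ^ 2 * (4 * Z₀) * V ^ 2 := by
        rw [Finset.sum_const, Finset.sum_const, Nat.card_Ioc, Nat.sub_zero, nsmul_eq_mul, nsmul_eq_mul]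
        push_cast
        ring

end Summit.Parity.BatemanHorn.Cruxes.SplitBlockJacobiCorner.Sketch.MbbOfBoxInputs

namespace Summit.Parity.BatemanHorn.Cruxes.SplitBlockJacobiCorner.Sketch

/-- **Registered stub form** (the box `(P/d, t/d]` is at most one step beyond dyadic): restated in `∀`-form in the crux-line namespace under
the name registered on stmt-Parity-15002. [folklore] -/
theorem mbbBoundsI_div_le :
    ∀ t P d : ℕ, t ≤ 2 * P → t / d ≤ 2 * (P / d) + 1 :=
  fun _ _ _ ht => MbbOfBoxInputs.div_le_two_mul_div_add_one ht

end Summit.Parity.BatemanHorn.Cruxes.SplitBlockJacobiCorner.Sketch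

end
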